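import Mathlib.Analysis.InnerProductSpace.PiL2
import HarnessLib

/-!
# Operator norms of multilinear forms on `ℝⁿ` are bounded by the sums of their entries

Elementary finite-dimensional estimates (everything PROVED; no definitions, no named facts): for a
continuous linear map `T` out of `EuclideanSpace ℝ ι`, `‖T‖ ≤ ∑ᵢ ‖T eᵢ‖` over the standard basis
`eᵢ = EuclideanSpace.single i 1` (`opNorm_le_sum_single`), and, iterating, the operator norms of
curried bi-, tri- and quadrilinear forms are bounded by the `ℓ¹`-sums of their entries
(`opNorm_le_sum_entries₂`, `₃`, `₄`). These convert entrywise (`|T(e_{a₁},…,e_{a_q})|`) control of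
tensors — the form in which `Cᵏ`-closeness of metrics is stated in
`Literature.Geometry.Riemannian.CkNecks` (`cylNorm`, R. Hamilton, Comm. Anal. Geom. 5 (1997), §C2,
(A)–(B)) — into the operator-norm control used by the coordinate curvature calculus
(`Literature.Geometry.Lorentzian.CoordRicciPerturbation`).

## References

* R. S. Hamilton, *Four-manifolds with positive isotropic curvature*, Comm. Anal. Geom. 5 (1997),
  §C2, p. 31. [Hamilton1997]
-/

noncomputable section

-- instance search on the nested operator spaces of multilinear forms
set_option maxSynthPendingDepth 3

open scoped RealInnerProductSpace

namespace Literature.Analysis.InnerProduct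

section Entries

variable {ι : Type*} [Fintype ι] [DecidableEq ι]
  {F : Type*} [NormedAddCommGroup F] [NormedSpace ℝ F]

/-- Expansion in the standard basis: `v = ∑ᵢ vᵢ eᵢ`. [folklore] -/
theorem sum_apply_smul_single (v : EuclideanSpace ℝ ι) :
    ∑ i, v i • EuclideanSpace.single i (1 : ℝ) = v := by
  conv_rhs => rw [← (EuclideanSpace.basisFun ι ℝ).sum_repr v]
  refine Finset.sum_congr rfl fun i _ ↦ ?_
  rw [EuclideanSpace.basisFun_repr, EuclideanSpace.basisFun_apply]

/-- **`‖T‖ ≤ ∑ᵢ ‖T eᵢ‖`** for a continuous linear map out of `ℝⁿ` (`T v = ∑ vᵢ T eᵢ`,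
`|vᵢ| ≤ ‖v‖`, `PiLp.norm_apply_le`). [folklore] -/
theorem opNorm_le_sum_single (T : EuclideanSpace ℝ ι →L[ℝ] F) :
    ‖T‖ ≤ ∑ i, ‖T (EuclideanSpace.single i (1 : ℝ))‖ := by
  refine ContinuousLinearMap.opNorm_le_bound _ (Finset.sum_nonneg fun i _ ↦ norm_nonneg _)
    fun v ↦ ?_
  have hexp : T v = ∑ i, v i • T (EuclideanSpace.single i (1 : ℝ)) := by
    conv_lhs => rw [← sum_apply_smul_single v]
    rw [map_sum]
    exact Finset.sum_congr rfl fun i _ ↦ by rw [map_smul]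
  rw [hexp, Finset.sum_mul]
  refine (norm_sum_le _ _).trans (Finset.sum_le_sum fun i _ ↦ ?_)
  rw [norm_smul, mul_comm]
  exact mul_le_mul_of_nonneg_left (PiLp.norm_apply_le v i) (norm_nonneg _)

/-- **Bilinear forms**: `‖β‖ ≤ ∑ᵢ ∑ⱼ ‖β eᵢ eⱼ‖`. [folklore] -/
theorem opNorm_le_sum_entries₂ (β : EuclideanSpace ℝ ι →L[ℝ] EuclideanSpace ℝ ι →L[ℝ] F) :
    ‖β‖ ≤ ∑ i, ∑ j, ‖β (EuclideanSpace.single i (1 : ℝ)) (EuclideanSpace.single j (1 : ℝ))‖ :=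
  (opNorm_le_sum_single β).trans (Finset.sum_le_sum fun _ _ ↦ opNorm_le_sum_single _)

/-- **Trilinear forms**: `‖T‖ ≤ ∑ᵢ ∑ⱼ ∑ₖ ‖T eᵢ eⱼ eₖ‖`. [folklore] -/
theorem opNorm_le_sum_entries₃
    (T : EuclideanSpace ℝ ι →L[ℝ] EuclideanSpace ℝ ι →L[ℝ] EuclideanSpace ℝ ι →L[ℝ] F) :
    ‖T‖ ≤ ∑ i, ∑ j, ∑ k, ‖T (EuclideanSpace.single i (1 : ℝ)) (EuclideanSpace.single j (1 : ℝ))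
      (EuclideanSpace.single k (1 : ℝ))‖ :=
  (opNorm_le_sum_single T).trans (Finset.sum_le_sum fun _ _ ↦ opNorm_le_sum_entries₂ _)

/-- **Quadrilinear forms**: `‖T‖ ≤ ∑ᵢ ∑ⱼ ∑ₖ ∑ₗ ‖T eᵢ eⱼ eₖ eₗ‖`. [folklore] -/
theorem opNorm_le_sum_entries₄
    (T : EuclideanSpace ℝ ι →L[ℝ] EuclideanSpace ℝ ι →L[ℝ] EuclideanSpace ℝ ι →L[ℝ]
      EuclideanSpace ℝ ι →L[ℝ] F) :
    ‖T‖ ≤ ∑ i, ∑ j, ∑ k, ∑ l, ‖T (EuclideanSpace.single i (1 : ℝ)) (EuclideanSpace.single j (1 : ℝ))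
      (EuclideanSpace.single k (1 : ℝ)) (EuclideanSpace.single l (1 : ℝ))‖ :=
  (opNorm_le_sum_single T).trans (Finset.sum_le_sum fun _ _ ↦ opNorm_le_sum_entries₃ _)

/-- **Uniform entry bounds give operator-norm bounds**, bilinear case:
if `‖β eᵢ eⱼ‖ ≤ C` for all `i, j` then `‖β‖ ≤ n² C` (`n = card ι`). [folklore] -/
theorem opNorm_le_card_sq_mul_of_entries₂ (β : EuclideanSpace ℝ ι →L[ℝ] EuclideanSpace ℝ ι →L[ℝ] F)
    {C : ℝ} (hC : ∀ i j, ‖β (EuclideanSpace.single i (1 : ℝ)) (EuclideanSpace.single j (1 : ℝ))‖ ≤ C) :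
    ‖β‖ ≤ (Fintype.card ι : ℝ) ^ 2 * C := by
  refine (opNorm_le_sum_entries₂ β).trans ?_
  calc ∑ i, ∑ j, ‖β (EuclideanSpace.single i (1 : ℝ)) (EuclideanSpace.single j (1 : ℝ))‖
      ≤ ∑ _i : ι, ∑ _j : ι, C := Finset.sum_le_sum fun i _ ↦ Finset.sum_le_sum fun j _ ↦ hC i j
    _ = (Fintype.card ι : ℝ) ^ 2 * C := by
        simp only [Finset.sum_const, Finset.card_univ, nsmul_eq_mul]; ring

/-- Uniform entry bounds, trilinear case: `‖T‖ ≤ n³ C`. [folklore] -/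
theorem opNorm_le_card_pow_three_mul_of_entries₃
    (T : EuclideanSpace ℝ ι →L[ℝ] EuclideanSpace ℝ ι →L[ℝ] EuclideanSpace ℝ ι →L[ℝ] F) {C : ℝ}
    (hC : ∀ i j k, ‖T (EuclideanSpace.single i (1 : ℝ)) (EuclideanSpace.single j (1 : ℝ))
      (EuclideanSpace.single k (1 : ℝ))‖ ≤ C) :
    ‖T‖ ≤ (Fintype.card ι : ℝ) ^ 3 * C := by
  refine (opNorm_le_sum_entries₃ T).trans ?_
  calc ∑ i, ∑ j, ∑ k, ‖T (EuclideanSpace.single i (1 : ℝ)) (EuclideanSpace.single j (1 : ℝ))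
        (EuclideanSpace.single k (1 : ℝ))‖
      ≤ ∑ _i : ι, ∑ _j : ι, ∑ _k : ι, C :=
        Finset.sum_le_sum fun i _ ↦ Finset.sum_le_sum fun j _ ↦ Finset.sum_le_sum fun k _ ↦ hC i j k
    _ = (Fintype.card ι : ℝ) ^ 3 * C := by
        simp only [Finset.sum_const, Finset.card_univ, nsmul_eq_mul]; ring

/-- Uniform entry bounds, quadrilinear case: `‖T‖ ≤ n⁴ C`. [folklore] -/
theorem opNorm_le_card_pow_four_mul_of_entries₄
    (T : EuclideanSpace ℝ ι →L[ℝ] EuclideanSpace ℝ ι →L[ℝ] EuclideanSpace ℝ ι →L[ℝ]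
      EuclideanSpace ℝ ι →L[ℝ] F) {C : ℝ}
    (hC : ∀ i j k l, ‖T (EuclideanSpace.single i (1 : ℝ)) (EuclideanSpace.single j (1 : ℝ))
      (EuclideanSpace.single k (1 : ℝ)) (EuclideanSpace.single l (1 : ℝ))‖ ≤ C) :
    ‖T‖ ≤ (Fintype.card ι : ℝ) ^ 4 * C := by
  refine (opNorm_le_sum_entries₄ T).trans ?_
  calc ∑ i, ∑ j, ∑ k, ∑ l, ‖T (EuclideanSpace.single i (1 : ℝ)) (EuclideanSpace.single j (1 : ℝ))
        (EuclideanSpace.single k (1 : ℝ)) (EuclideanSpace.single l (1 : ℝ))‖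
      ≤ ∑ _i : ι, ∑ _j : ι, ∑ _k : ι, ∑ _l : ι, C :=
        Finset.sum_le_sum fun i _ ↦ Finset.sum_le_sum fun j _ ↦ Finset.sum_le_sum fun k _ ↦
          Finset.sum_le_sum fun l _ ↦ hC i j k l
    _ = (Fintype.card ι : ℝ) ^ 4 * C := by
        simp only [Finset.sum_const, Finset.card_univ, nsmul_eq_mul]; ring

/-- **A single entry is bounded by the `ℓ²`-sum of all entries**: for any real-valued function
`T` on index tuples and any tuple `a`, `|T a| ≤ (∑_{a'} T(a')²)^{1/2}` — the passage from the
Hilbert–Schmidt-type norms `cylNorm` of `Literature.Geometry.Riemannian.CkNecks` to entrywise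
bounds. [folklore] -/
theorem abs_le_sqrt_sum_sq {α : Type*} [Fintype α] (T : α → ℝ) (a : α) :
    |T a| ≤ Real.sqrt (∑ a', T a' ^ 2) := by
  rw [← Real.sqrt_sq_eq_abs]
  exact Real.sqrt_le_sqrt (Finset.single_le_sum (f := fun a' ↦ T a' ^ 2)
    (fun a' _ ↦ sq_nonneg (T a')) (Finset.mem_univ a))

end Entries

end Literature.Analysis.InnerProduct

end
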